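import Literature.NumberTheory.Automorphic.GL2CArchOps
import Mathlib.Analysis.Normed.Algebra.MatrixExponential
import Mathlib.Analysis.SpecialFunctions.Complex.Arg
import Mathlib.Analysis.SpecialFunctions.Trigonometric.Inverse
import HarnessLib

/-!
# `U(2)` is a product of one-parameter subgroups: Euler angles

Every unitary `2 × 2` matrix is
`k = exp(iψ·1) · exp(iα H) · exp(β(E − F)) · exp(iγ H)` for real `ψ, α, β, γ`
(`exists_eulerAngles_of_mem_unitaryGroup`), and the four exponents are skew-Hermitian; packaged as
`exists_exp_prod_of_mem_unitaryGroup`: **`k = exp Z₁ exp Z₂ exp Z₃ exp Z₄` with `Zᵢᴴ = −Zᵢ`**.  Used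
to integrate the infinitesimal `𝔲(2)`-equivariance of the Eichler–Shimura–Harder cochains
(`GL2CESHFamily`) to the `U(2)`-equivariance required by `GL2CEquivariantPrimitive.IsCochain`.
Ingredients: `exp` of a diagonal matrix (`Matrix.exp_diagonal`), `exp(β(E−F))` is the rotation by
`β` (conjugate `E − F` to `diag(i, −i)`, `Matrix.exp_conj`), and the parametrisation of
`SU(2) = {[[a, b], [−b̄, ā]]}` by `cos β = |a|`, phases `arg a = α + γ`, `arg b = α − γ`.
[cite: Knapp2002, §I.1 (SU(2))] [cite: Hall2015, Prop. 2.3 and Exercise 1.9]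

Theorems only (plus the explicit rotation matrix `rot` and eigenvector matrix `eigV`); no named fact.
-/

noncomputable section

open scoped Matrix ComplexConjugate Real
open Complex Matrix

namespace Literature.NumberTheory.Automorphic

namespace UnitaryTwo

open GL2CKType

/-- Shorthand. -/
local notation "Mat" => Matrix (Fin 2) (Fin 2) ℂ

/-! ### The four exponentials -/

/-- `exp(c · 1) = e^c · 1`. [folklore] -/
theorem exp_smul_one (c : ℂ) : NormedSpace.exp (c • (1 : Mat)) = Complex.exp c • (1 : Mat) := by
  have h1 : c • (1 : Mat) = diagonal fun _ => c := by
    ext i j; by_cases h : i = j <;> simp [h]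
  have h2 : Complex.exp c • (1 : Mat) = diagonal fun _ => Complex.exp c := by
    ext i j; by_cases h : i = j <;> simp [h]
  rw [h1, h2, exp_diagonal]
  congr 1
  funext i
  rw [Pi.coe_exp]
  exact (congrFun Complex.exp_eq_exp_ℂ c).symm

/-- `exp(c H) = diag(e^c, e^{−c})`. [folklore] -/
theorem exp_smul_mH (c : ℂ) : NormedSpace.exp (c • mH) = !![Complex.exp c, 0; 0, Complex.exp (-c)] := by
  have h1 : c • mH = diagonal ![c, -c] := by
    rw [mH_eq]; ext i j; fin_cases i <;> fin_cases j <;> simp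
  have h2 : (!![Complex.exp c, 0; 0, Complex.exp (-c)] : Mat) = diagonal ![Complex.exp c, Complex.exp (-c)] := by
    ext i j; fin_cases i <;> fin_cases j <;> simp
  rw [h1, h2, exp_diagonal]
  congr 1
  funext i
  rw [Pi.coe_exp, ← Complex.exp_eq_exp_ℂ]
  fin_cases i <;> rfl

/-- The rotation `R_β = [[cos β, sin β], [−sin β, cos β]]`. [folklore] -/
def rot (β : ℝ) : Mat := !![(Real.cos β : ℂ), (Real.sin β : ℂ); -(Real.sin β : ℂ), (Real.cos β : ℂ)]

/-- The eigenvector matrix `V = [[1, 1], [i, −i]]` of `E − F`. [folklore] -/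
def eigV : Mat := !![1, 1; I, -I]

/-- `det V = −2i ≠ 0`. [folklore] -/
theorem isUnit_det_eigV : IsUnit (eigV).det := by
  rw [eigV, det_fin_two_of]
  have : (1 : ℂ) * -I - 1 * I = -(2 * I) := by ring
  rw [this]
  exact (isUnit_iff_ne_zero.2 (mul_ne_zero two_ne_zero I_ne_zero)).neg

/-- `(E − F) V = V diag(i, −i)`. [folklore] -/
theorem mE_sub_mF_mul_eigV : (mE - mF) * eigV = eigV * diagonal ![I, -I] := by
  rw [mE_eq, mF_eq, eigV]
  ext i j; fin_cases i <;> fin_cases j <;> simp [Matrix.mul_apply, Fin.sum_univ_two]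

/-- `e^{iβ} = cos β + i sin β` with real `cos`, `sin`. [folklore] -/
theorem exp_ofReal_mul_I (β : ℝ) : Complex.exp ((β : ℂ) * I) = Real.cos β + Real.sin β * I := by
  rw [exp_mul_I, ← ofReal_cos, ← ofReal_sin]

/-- `e^{−iβ} = cos β − i sin β`. [folklore] -/
theorem exp_neg_ofReal_mul_I (β : ℝ) : Complex.exp (-((β : ℂ) * I)) = Real.cos β - Real.sin β * I := by
  rw [show -((β : ℂ) * I) = ((-β : ℝ) : ℂ) * I by push_cast; ring, exp_ofReal_mul_I, Real.cos_neg, Real.sin_neg]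
  push_cast; ring

/-- `R_β V = V diag(e^{iβ}, e^{−iβ})`. [folklore] -/
theorem rot_mul_eigV (β : ℝ) :
    rot β * eigV = eigV * diagonal ![Complex.exp ((β : ℂ) * I), Complex.exp (-((β : ℂ) * I))] := by
  rw [rot, eigV, exp_ofReal_mul_I, exp_neg_ofReal_mul_I]
  ext i j; fin_cases i <;> fin_cases j <;> simp [Matrix.mul_apply, Fin.sum_univ_two] <;> ring_nf <;>
    simp only [I_sq] <;> ring

/-- `A V = V B` with `V` invertible gives `A = V B V⁻¹`. [folklore] -/
theorem eq_conj_of_mul_eq {A B V : Mat} (hV : IsUnit V.det) (h : A * V = V * B) : A = V * B * V⁻¹ := by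
  rw [← h, Matrix.mul_assoc, mul_nonsing_inv _ hV, Matrix.mul_one]

/-- **`exp(β(E − F))` is the rotation by `β`.** [cite: Hall2015, Exercise 1.9] -/
theorem exp_smul_mE_sub_mF (β : ℝ) : NormedSpace.exp ((β : ℂ) • (mE - mF)) = rot β := by
  have hV := isUnit_det_eigV
  have hA : (β : ℂ) • (mE - mF) = eigV * ((β : ℂ) • diagonal ![I, -I]) * eigV⁻¹ := by
    refine eq_conj_of_mul_eq hV ?_
    rw [smul_mul_assoc, mE_sub_mF_mul_eigV, mul_smul_comm]
  have hR : rot β = eigV * diagonal ![Complex.exp ((β : ℂ) * I), Complex.exp (-((β : ℂ) * I))] * eigV⁻¹ :=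
    eq_conj_of_mul_eq hV (rot_mul_eigV β)
  rw [hA, exp_conj _ _ ((isUnit_iff_isUnit_det _).2 hV), hR]
  congr 2
  have : (β : ℂ) • diagonal ![I, -I] = diagonal ![(β : ℂ) * I, -((β : ℂ) * I)] := by
    ext i j; fin_cases i <;> fin_cases j <;> simp
  rw [this, exp_diagonal]
  congr 1
  funext i
  rw [Pi.coe_exp, ← Complex.exp_eq_exp_ℂ]
  fin_cases i <;> rfl

/-! ### Skew-Hermitian exponents -/

/-- `conj (iθ) = −iθ` for real `θ`. [folklore] -/
theorem conj_ofReal_mul_I (θ : ℝ) : conj ((θ : ℂ) * I) = -((θ : ℂ) * I) := by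
  rw [map_mul, conj_ofReal, conj_I]; ring

/-- `(iψ · 1)ᴴ = −(iψ · 1)`. [folklore] -/
theorem conjTranspose_I_smul_one (ψ : ℝ) : ((((ψ : ℂ) * I) • (1 : Mat)))ᴴ = -(((ψ : ℂ) * I) • (1 : Mat)) := by
  rw [conjTranspose_smul, conjTranspose_one, ← neg_smul, star_def, conj_ofReal_mul_I]

/-- `(iα H)ᴴ = −iα H`. [folklore] -/
theorem conjTranspose_I_smul_mH' (α : ℝ) : ((((α : ℂ) * I) • mH))ᴴ = -(((α : ℂ) * I) • mH) := by
  have hH : mHᴴ = mH := by rw [mH_eq]; ext i j; fin_cases i <;> fin_cases j <;> simp [conjTranspose]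
  rw [conjTranspose_smul, hH, ← neg_smul, star_def, conj_ofReal_mul_I]

/-- `(β(E − F))ᴴ = −β(E − F)`. [folklore] -/
theorem conjTranspose_smul_mE_sub_mF (β : ℝ) : (((β : ℂ) • (mE - mF)))ᴴ = -((β : ℂ) • (mE - mF)) := by
  rw [conjTranspose_smul, conjTranspose_mE_sub_mF, smul_neg, star_def, conj_ofReal]

/-! ### The entries of a unitary `2 × 2` matrix -/

/-- For unitary `k`: `|k₀₀|² + |k₀₁|² = 1`. [cite: Knapp2002, §I.1] -/
theorem normSq_add_normSq {k : Mat} (hk : k ∈ unitaryGroup (Fin 2) ℂ) :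
    Complex.normSq (k 0 0) + Complex.normSq (k 0 1) = 1 := by
  have h := congrFun (congrFun (mem_unitaryGroup_iff.1 hk) 0) 0
  rw [Matrix.mul_apply, Fin.sum_univ_two, Matrix.one_apply_eq] at h
  simp only [star_apply, star_def] at h
  rw [mul_conj, mul_conj] at h
  exact_mod_cast h

/-- For unitary `k` with `δ = det k`: `k₁₁ = δ k̄₀₀` and `k₁₀ = −δ k̄₀₁`. [cite: Knapp2002, §I.1] -/
theorem entries_of_mem_unitaryGroup {k : Mat} (hk : k ∈ unitaryGroup (Fin 2) ℂ) :
    k 1 1 = k.det * conj (k 0 0) ∧ k 1 0 = -(k.det * conj (k 0 1)) := by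
  have hinv : k⁻¹ = star k := inv_eq_left_inv (mem_unitaryGroup_iff'.1 hk)
  have hdet : IsUnit k.det := (isUnit_iff_isUnit_det _).1 ⟨⟨k, star k, mem_unitaryGroup_iff.1 hk,
    mem_unitaryGroup_iff'.1 hk⟩, rfl⟩
  have hadj : k.adjugate = k.det • star k := by
    rw [← hinv, Matrix.inv_def, smul_smul, Ring.mul_inverse_cancel _ hdet, one_smul]
  rw [adjugate_fin_two] at hadj
  have h00 := congrFun (congrFun hadj 0) 0
  have h10 := congrFun (congrFun hadj 1) 0
  simp only [of_apply, cons_val', cons_val_zero, cons_val_one, cons_val_fin_one, empty_val', Matrix.smul_apply,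
    star_apply, star_def, smul_eq_mul] at h00 h10
  exact ⟨h00, by rw [← neg_eq_iff_eq_neg]; exact h10⟩

/-- `|det k| = 1` for unitary `k`. [folklore] -/
theorem norm_det_of_mem_unitaryGroup {k : Mat} (hk : k ∈ unitaryGroup (Fin 2) ℂ) : ‖k.det‖ = 1 := by
  have h : star k * k = 1 := mem_unitaryGroup_iff'.1 hk
  have hd := congrArg Matrix.det h
  rw [det_mul, det_one, star_eq_conjTranspose, det_conjTranspose, star_def, conj_mul'] at hd
  have : ‖k.det‖ ^ 2 = 1 := by exact_mod_cast hd
  nlinarith [norm_nonneg k.det]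

/-! ### Euler angles -/

/-- The Euler product `e^{iψ} diag(e^{iα}, e^{−iα}) R_β diag(e^{iγ}, e^{−iγ})`, entrywise. [cite: Knapp2002, §I.1] -/
theorem euler_product (ψ α β γ : ℝ) :
    NormedSpace.exp ((((ψ : ℂ) * I)) • (1 : Mat)) * NormedSpace.exp (((α : ℂ) * I) • mH) *
        NormedSpace.exp ((β : ℂ) • (mE - mF)) * NormedSpace.exp (((γ : ℂ) * I) • mH) =
      !![Complex.exp ((ψ : ℂ) * I) * (Complex.exp ((α : ℂ) * I) * Real.cos β * Complex.exp ((γ : ℂ) * I)),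
          Complex.exp ((ψ : ℂ) * I) * (Complex.exp ((α : ℂ) * I) * Real.sin β * Complex.exp (-((γ : ℂ) * I)));
        Complex.exp ((ψ : ℂ) * I) * (Complex.exp (-((α : ℂ) * I)) * -Real.sin β * Complex.exp ((γ : ℂ) * I)),
          Complex.exp ((ψ : ℂ) * I) * (Complex.exp (-((α : ℂ) * I)) * Real.cos β * Complex.exp (-((γ : ℂ) * I)))] := by
  rw [exp_smul_one, exp_smul_mH, exp_smul_mE_sub_mF, exp_smul_mH, rot]
  ext i j
  fin_cases i <;> fin_cases j <;> simp [Matrix.mul_apply, Fin.sum_univ_two] <;> ring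

/-- `conj (e^{iθ}) = e^{−iθ}`. [folklore] -/
theorem conj_exp_ofReal_mul_I (θ : ℝ) : conj (Complex.exp ((θ : ℂ) * I)) = Complex.exp (-((θ : ℂ) * I)) := by
  rw [← Complex.exp_conj, conj_ofReal_mul_I]

/-- **Euler angles: every `k ∈ U(2)` is `exp(iψ·1) exp(iα H) exp(β(E−F)) exp(iγ H)`.**
[cite: Knapp2002, §I.1] [cite: Hall2015, Prop. 2.3] -/
theorem exists_eulerAngles_of_mem_unitaryGroup {k : Mat} (hk : k ∈ unitaryGroup (Fin 2) ℂ) :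
    ∃ ψ α β γ : ℝ, k = NormedSpace.exp ((((ψ : ℂ) * I)) • (1 : Mat)) * NormedSpace.exp (((α : ℂ) * I) • mH) *
      NormedSpace.exp ((β : ℂ) • (mE - mF)) * NormedSpace.exp (((γ : ℂ) * I) • mH) := by
  obtain ⟨h11, h10⟩ := entries_of_mem_unitaryGroup hk
  -- `det k = e^{2iψ}`
  have hδn : ‖k.det‖ = 1 := norm_det_of_mem_unitaryGroup hk
  set ψ : ℝ := arg k.det / 2 with hψ
  have hδe : k.det = Complex.exp ((ψ : ℂ) * I) * Complex.exp ((ψ : ℂ) * I) := by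
    rw [← Complex.exp_add]
    conv_lhs => rw [← norm_mul_exp_arg_mul_I k.det, hδn, ofReal_one, one_mul]
    congr 1
    rw [hψ]; push_cast; ring
  set u := Complex.exp (-((ψ : ℂ) * I)) with hu
  have huinv : Complex.exp ((ψ : ℂ) * I) * u = 1 := by
    rw [hu, ← Complex.exp_add, add_neg_cancel, Complex.exp_zero]
  have hun : ‖u‖ = 1 := by
    rw [hu, show -((ψ : ℂ) * I) = ((-ψ : ℝ) : ℂ) * I by push_cast; ring, norm_exp_ofReal_mul_I]
  have hconju : conj u = Complex.exp ((ψ : ℂ) * I) := by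
    rw [hu, ← Complex.exp_conj, map_neg, conj_ofReal_mul_I, neg_neg]
  -- the `SU(2)` part
  set a := u * k 0 0 with ha
  set b := u * k 0 1 with hb
  have hab : ‖a‖ ^ 2 + ‖b‖ ^ 2 = 1 := by
    rw [ha, hb, norm_mul, norm_mul, hun, one_mul, one_mul, ← Complex.normSq_eq_norm_sq, ← Complex.normSq_eq_norm_sq]
    exact normSq_add_normSq hk
  have ha1 : ‖a‖ ≤ 1 := by nlinarith [norm_nonneg a, norm_nonneg b, sq_nonneg ‖b‖]
  set β : ℝ := Real.arccos ‖a‖ with hβ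
  have hcos : Real.cos β = ‖a‖ := by rw [hβ, Real.cos_arccos (by linarith [norm_nonneg a]) ha1]
  have hsin : Real.sin β = ‖b‖ := by
    rw [hβ, Real.sin_arccos]
    have : 1 - ‖a‖ ^ 2 = ‖b‖ ^ 2 := by linarith
    rw [this, Real.sqrt_sq (norm_nonneg b)]
  set α : ℝ := (arg a + arg b) / 2 with hα
  set γ : ℝ := (arg a - arg b) / 2 with hγ
  have eA : Complex.exp ((α : ℂ) * I) * Complex.exp ((γ : ℂ) * I) = Complex.exp ((arg a : ℂ) * I) := by
    rw [← Complex.exp_add]; congr 1; rw [hα, hγ]; push_cast; ring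
  have eB : Complex.exp ((α : ℂ) * I) * Complex.exp (-((γ : ℂ) * I)) = Complex.exp ((arg b : ℂ) * I) := by
    rw [← Complex.exp_add]; congr 1; rw [hα, hγ]; push_cast; ring
  have hae : Complex.exp ((α : ℂ) * I) * Real.cos β * Complex.exp ((γ : ℂ) * I) = a := by
    rw [mul_right_comm, eA, hcos, mul_comm]; exact norm_mul_exp_arg_mul_I a
  have hbe : Complex.exp ((α : ℂ) * I) * Real.sin β * Complex.exp (-((γ : ℂ) * I)) = b := by
    rw [mul_right_comm, eB, hsin, mul_comm]; exact norm_mul_exp_arg_mul_I b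
  have hae' : Complex.exp (-((α : ℂ) * I)) * Real.cos β * Complex.exp (-((γ : ℂ) * I)) = conj a := by
    rw [← hae, map_mul, map_mul, conj_exp_ofReal_mul_I, conj_exp_ofReal_mul_I, conj_ofReal]
  have hbe' : Complex.exp (-((α : ℂ) * I)) * -Real.sin β * Complex.exp ((γ : ℂ) * I) = -conj b := by
    rw [← hbe, map_mul, map_mul, conj_exp_ofReal_mul_I, ← Complex.exp_conj (-((γ : ℂ) * I)), map_neg,
      conj_ofReal_mul_I, neg_neg, conj_ofReal]
    ring
  refine ⟨ψ, α, β, γ, ?_⟩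
  rw [euler_product, hae, hbe, hae', hbe']
  -- compare entries
  have hk00 : k 0 0 = Complex.exp ((ψ : ℂ) * I) * a := by rw [ha, ← mul_assoc, huinv, one_mul]
  have hk01 : k 0 1 = Complex.exp ((ψ : ℂ) * I) * b := by rw [hb, ← mul_assoc, huinv, one_mul]
  have hk11 : k 1 1 = Complex.exp ((ψ : ℂ) * I) * conj a := by
    rw [h11, ha, map_mul, hconju, hδe]; ring
  have hk10 : k 1 0 = Complex.exp ((ψ : ℂ) * I) * -conj b := by
    rw [h10, hb, map_mul, hconju, hδe]; ring
  ext i j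
  fin_cases i <;> fin_cases j
  · simpa using hk00
  · simpa using hk01
  · simpa using hk10
  · simpa using hk11

/-- **Every `k ∈ U(2)` is a product of four exponentials of skew-Hermitian matrices.**
[cite: Knapp2002, §I.1] [cite: Hall2015, Prop. 2.3] -/
theorem exists_exp_prod_of_mem_unitaryGroup {k : Mat} (hk : k ∈ unitaryGroup (Fin 2) ℂ) :
    ∃ Z : Fin 4 → Mat, (∀ i, (Z i)ᴴ = -Z i) ∧
      k = NormedSpace.exp (Z 0) * NormedSpace.exp (Z 1) * NormedSpace.exp (Z 2) * NormedSpace.exp (Z 3) := by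
  obtain ⟨ψ, α, β, γ, h⟩ := exists_eulerAngles_of_mem_unitaryGroup hk
  refine ⟨![(((ψ : ℂ) * I)) • (1 : Mat), ((α : ℂ) * I) • mH, (β : ℂ) • (mE - mF), ((γ : ℂ) * I) • mH], ?_, ?_⟩
  · intro i
    fin_cases i
    · exact conjTranspose_I_smul_one ψ
    · exact conjTranspose_I_smul_mH' α
    · exact conjTranspose_smul_mE_sub_mF β
    · exact conjTranspose_I_smul_mH' γ
  · simpa using h

end UnitaryTwo

end Literature.NumberTheory.Automorphic

end
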